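import Literature.Analysis.FluidPDE.TaoAveragedRotations
import HarnessLib

/-!
# Tao 2016, §3.7: the closed triangle `ξ̃ ∈ Γ` and the closing rotations `R_{j,ξ₁,ξ₂,ξ₃}`
((3.17)–(3.18)), explicitly

T. Tao, *Finite time blowup for an averaged three-dimensional Navier–Stokes equation*,
J. Amer. Math. Soc. **29** (2016), 601–674 = arXiv:1402.0290v3 (held as `paper:arxiv-1402.0290`;
equation and page numbers are those of that text), §3.7, p. 19: "Observe from (3.7') and the
implicit function theorem (for `ε₀` small enough) that if `ξⱼ ∈ B(ξⱼ⁰, ε₀³)` for `j = 1,2,3`, one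
can find rotations `R_{j,ξ₁,ξ₂,ξ₃} ∈ SO(3)` for `j = 1,2,3` with `R_{j,ξ₁,ξ₂,ξ₃} = I + O(ε₀³)` … and
the tuple `(ξ̃₁, ξ̃₂, ξ̃₃)` defined by `ξ̃ⱼ := R_{j,ξ₁,ξ₂,ξ₃} ξⱼ` (3.17) lives in the space
`Γ := {(η₁,η₂,η₃) ∈ Πⱼ B(ξⱼ⁰, Cε₀³) : η₁ + η₂ + η₃ = 0}` (3.18) … Furthermore, from the implicit
function theorem we may make `R_{j,ξ₁,ξ₂,ξ₃}` and hence `ξ̃₁, ξ̃₂, ξ̃₃` depend smoothly on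
`ξ₁,ξ₂,ξ₃`".

`TaoAveragedRotations.lean` supplies the rotation `rotTo x y ∈ SO(3)` taking a unit vector `x` to
a unit vector `y` (smooth in `(x, y)`, the identity at `y = x`). This file supplies the other
half of (3.17)–(3.18) — **the target triple `ξ̃`** — by an explicit smooth triangle construction
(replacing the implicit function theorem), and packages the closing rotations:

* `closTarget ξ = ξ̃` — **the closed triangle**: with the frame `e = ξ₃/|ξ₃|`, `f ⊥ e` the unit
  vector in the plane of `ξ₃, ξ₁` on the side of `ξ₁`, the law-of-cosines length
  `α = (|ξ₃|²+|ξ₁|²-|ξ₂|²)/(2|ξ₃|)` and the height `β = (|ξ₁|²-α²)^{1/2}`: `ξ̃₃ = ξ₃`,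
  `ξ̃₁ = -α e + β f`, `ξ̃₂ = -ξ̃₃ - ξ̃₁`; `closTarget_sum` (**`ξ̃₁+ξ̃₂+ξ̃₃ = 0`**), `norm_closTarget`
  (**`|ξ̃ⱼ| = |ξⱼ|`**), `closTarget_xi0` (`ξ̃(ξ⁰) = ξ⁰`), `contDiffAt_closTarget` (smooth in `ξ`);
* `closRot ξ j = R_{j,ξ}` — **the closing rotations** `rotToEquiv (ξⱼ/|ξⱼ|) (ξ̃ⱼ/|ξ̃ⱼ|)` for
  `j = 1, 2` and the identity for `j = 3`: `det_closRot` (`∈ SO(3)`), `closRot_apply_self`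
  (**`R_{j,ξ} ξⱼ = ξ̃ⱼ`**), `sum_closRot_apply_self` (**`Σⱼ R_{j,ξ} ξⱼ = 0`**, i.e. `ξ̃ ∈ Γ`),
  `closRot_xi0_apply` (`R_{j,ξ⁰} = I`), `contDiffAt_closRot_apply` (`ξ ↦ R_{j,ξ} X` smooth);
* `closAdmissible_nhds`, `closingRotations_near_xi0` — **all of this holds for `|ξⱼ - ξⱼ⁰| < δ`**
  for some `δ > 0`; the printed "`= I + O(ε₀³)`" / "`Γ ⊆ Πⱼ B(ξⱼ⁰, Cε₀³)`" are the quantitative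
  forms of the smoothness together with `R_{j,ξ⁰} = I`, `ξ̃(ξ⁰) = ξ⁰` (mean value inequality; not
  restated here).

## References

* T. Tao, J. Amer. Math. Soc. 29 (2016), 601–674, arXiv:1402.0290v3, §3.2 (3.7); §3.7
  (3.17)–(3.20) p. 19. Key `Tao2016AveragedNS`.
-/

noncomputable section

open Real Matrix MeasureTheory Filter Topology
open scoped RealInnerProductSpace

namespace Literature.Analysis.FluidPDE.Tao2016

/-- Local notation for physical / frequency space `ℝ³`. -/
local notation "ℝ³" => EuclideanSpace ℝ (Fin 3)

/-! ### §3.7: the closing rotations `R_{j,ξ₁,ξ₂,ξ₃}` and the closed triangle `ξ̃` (3.17)–(3.18) -/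

section Closing

/-- The unit vector `e = ξ₃/|ξ₃|` (first axis of the frame of the triangle construction). [folklore] -/
def closE (ξ : Fin 3 → ℝ³) : ℝ³ := udir (ξ 2)

/-- The Gram–Schmidt companion of `ξ₁` against `e` (unnormalised). [folklore] -/
def closV (ξ : Fin 3 → ℝ³) : ℝ³ := ξ 0 - ⟪ξ 0, closE ξ⟫ • closE ξ

/-- The unit vector `f ⊥ e` in the plane of `ξ₃, ξ₁`, on the side of `ξ₁`. [folklore] -/
def closF (ξ : Fin 3 → ℝ³) : ℝ³ := udir (closV ξ)

/-- The signed length `α = (|ξ₃|² + |ξ₁|² - |ξ₂|²)/(2|ξ₃|)` of the projection of the new `ξ̃₁` on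
`-e` (law of cosines for the triangle with side lengths `|ξ₁|, |ξ₂|, |ξ₃|`). [folklore] -/
def closAlpha (ξ : Fin 3 → ℝ³) : ℝ := (‖ξ 2‖ ^ 2 + ‖ξ 0‖ ^ 2 - ‖ξ 1‖ ^ 2) / (2 * ‖ξ 2‖)

/-- The height `β = (|ξ₁|² - α²)^{1/2}` of the triangle. [folklore] -/
def closBeta (ξ : Fin 3 → ℝ³) : ℝ := Real.sqrt (‖ξ 0‖ ^ 2 - closAlpha ξ ^ 2)

/-- The new first vector `ξ̃₁ = -α e + β f`. [folklore] -/
def closZeta0 (ξ : Fin 3 → ℝ³) : ℝ³ := -closAlpha ξ • closE ξ + closBeta ξ • closF ξ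

/-- **The closed triangle `ξ̃ = (ξ̃₁, ξ̃₂, ξ̃₃)`** (3.17)–(3.18): `ξ̃₃ = ξ₃`, `ξ̃₁ = -α e + β f`,
`ξ̃₂ = -ξ̃₃ - ξ̃₁`, so that `ξ̃₁ + ξ̃₂ + ξ̃₃ = 0` and `|ξ̃ⱼ| = |ξⱼ|` (an explicit substitute for the
implicit-function-theorem construction of §3.7). [cite: Tao2016AveragedNS, §3.7 (3.17)–(3.18) p. 19] -/
def closTarget (ξ : Fin 3 → ℝ³) : Fin 3 → ℝ³ := ![closZeta0 ξ, -ξ 2 - closZeta0 ξ, ξ 2]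

/-- `ξ̃₁ + ξ̃₂ + ξ̃₃ = 0` (by construction). [cite: Tao2016AveragedNS, §3.7 (3.18) p. 19] -/
theorem closTarget_sum (ξ : Fin 3 → ℝ³) : closTarget ξ 0 + closTarget ξ 1 + closTarget ξ 2 = 0 := by
  simp only [closTarget, Matrix.cons_val_zero, Matrix.cons_val_one, Matrix.cons_val_two, Matrix.head_cons,
    Matrix.tail_cons]
  abel

/-- The admissible region of the construction: `ξ₃ ≠ 0`, `ξ₁ ∦ ξ₃`, and a non-degenerate
triangle. [folklore] -/
def ClosGood (ξ : Fin 3 → ℝ³) : Prop :=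
  ξ 2 ≠ 0 ∧ closV ξ ≠ 0 ∧ closAlpha ξ ^ 2 < ‖ξ 0‖ ^ 2

variable {ξ : Fin 3 → ℝ³}

/-- `e ⊥ f`, both unit (on the admissible region). [folklore] -/
theorem closFrame (h : ClosGood ξ) :
    ‖closE ξ‖ = 1 ∧ ‖closF ξ‖ = 1 ∧ ⟪closE ξ, closF ξ⟫ = 0 := by
  obtain ⟨h2, hv, -⟩ := h
  have he : ‖closE ξ‖ = 1 := norm_udir h2
  refine ⟨he, norm_udir hv, ?_⟩
  rw [closF, udir, real_inner_smul_right, closV, inner_sub_right, real_inner_smul_right,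
    real_inner_self_eq_norm_sq, he, one_pow, mul_one, real_inner_comm, sub_self, mul_zero]

/-- `|ξ̃₁| = |ξ₁|`. [cite: Tao2016AveragedNS, §3.7 (3.17) p. 19] -/
theorem norm_closTarget_zero (h : ClosGood ξ) : ‖closTarget ξ 0‖ = ‖ξ 0‖ := by
  obtain ⟨he, hf, hef⟩ := closFrame h
  have hee : ⟪closE ξ, closE ξ⟫ = 1 := by rw [real_inner_self_eq_norm_sq, he, one_pow]
  have hff : ⟪closF ξ, closF ξ⟫ = 1 := by rw [real_inner_self_eq_norm_sq, hf, one_pow]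
  have hfe : ⟪closF ξ, closE ξ⟫ = 0 := by rw [real_inner_comm, hef]
  have hβ : closBeta ξ ^ 2 = ‖ξ 0‖ ^ 2 - closAlpha ξ ^ 2 := by
    rw [closBeta, Real.sq_sqrt (by linarith [h.2.2])]
  have hsq : ‖closTarget ξ 0‖ ^ 2 = ‖ξ 0‖ ^ 2 := by
    simp only [closTarget, Matrix.cons_val_zero, closZeta0]
    rw [← real_inner_self_eq_norm_sq]
    simp only [inner_add_left, inner_add_right, real_inner_smul_left, real_inner_smul_right, hee, hff,
      hef, hfe, mul_one, mul_zero, add_zero, zero_add]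
    nlinarith [hβ]
  have h0 : 0 ≤ ‖closTarget ξ 0‖ := norm_nonneg _
  have h1 : 0 ≤ ‖ξ 0‖ := norm_nonneg _
  nlinarith [hsq, sq_nonneg (‖closTarget ξ 0‖ - ‖ξ 0‖), sq_nonneg (‖closTarget ξ 0‖ + ‖ξ 0‖)]

/-- `|ξ̃₂| = |ξ₂|` (law of cosines). [cite: Tao2016AveragedNS, §3.7 (3.17) p. 19] -/
theorem norm_closTarget_one (h : ClosGood ξ) : ‖closTarget ξ 1‖ = ‖ξ 1‖ := by
  obtain ⟨he, hf, hef⟩ := closFrame h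
  have hee : ⟪closE ξ, closE ξ⟫ = 1 := by rw [real_inner_self_eq_norm_sq, he, one_pow]
  have hff : ⟪closF ξ, closF ξ⟫ = 1 := by rw [real_inner_self_eq_norm_sq, hf, one_pow]
  have hfe : ⟪closF ξ, closE ξ⟫ = 0 := by rw [real_inner_comm, hef]
  have h2 : ξ 2 ≠ 0 := h.1
  have hr : ‖ξ 2‖ ≠ 0 := norm_ne_zero_iff.mpr h2
  have hβ : closBeta ξ ^ 2 = ‖ξ 0‖ ^ 2 - closAlpha ξ ^ 2 := by
    rw [closBeta, Real.sq_sqrt (by linarith [h.2.2])]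
  have hα : closAlpha ξ * (2 * ‖ξ 2‖) = ‖ξ 2‖ ^ 2 + ‖ξ 0‖ ^ 2 - ‖ξ 1‖ ^ 2 :=
    div_mul_cancel₀ _ (mul_ne_zero two_ne_zero hr)
  have hξ2 : ξ 2 = ‖ξ 2‖ • closE ξ := by
    rw [closE, udir, smul_smul, mul_inv_cancel₀ hr, one_smul]
  have hexp : closTarget ξ 1 = (closAlpha ξ - ‖ξ 2‖) • closE ξ - closBeta ξ • closF ξ := by
    simp only [closTarget, Matrix.cons_val_one, Matrix.cons_val_zero, closZeta0]
    conv_lhs => rw [hξ2]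
    module
  have hsq : ‖closTarget ξ 1‖ ^ 2 = ‖ξ 1‖ ^ 2 := by
    rw [hexp, ← real_inner_self_eq_norm_sq]
    simp only [inner_sub_left, inner_sub_right, real_inner_smul_left, real_inner_smul_right, hee, hff,
      hef, hfe, mul_one, mul_zero, sub_zero]
    nlinarith [hβ, hα]
  have h0 : 0 ≤ ‖closTarget ξ 1‖ := norm_nonneg _
  have h1 : 0 ≤ ‖ξ 1‖ := norm_nonneg _
  nlinarith [hsq, sq_nonneg (‖closTarget ξ 1‖ - ‖ξ 1‖), sq_nonneg (‖closTarget ξ 1‖ + ‖ξ 1‖)]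

/-- `ξ̃₃ = ξ₃`. [cite: Tao2016AveragedNS, §3.7 (3.17) p. 19] -/
@[simp]
theorem closTarget_two (ξ : Fin 3 → ℝ³) : closTarget ξ 2 = ξ 2 := rfl

/-- `|ξ̃ⱼ| = |ξⱼ|` for all `j`. [cite: Tao2016AveragedNS, §3.7 (3.17) p. 19] -/
theorem norm_closTarget (h : ClosGood ξ) (j : Fin 3) : ‖closTarget ξ j‖ = ‖ξ j‖ := by
  match j with
  | 0 => exact norm_closTarget_zero h
  | 1 => exact norm_closTarget_one h
  | 2 => rfl

/-- At the configuration (3.7) the triangle is already closed: `ξ̃(ξ⁰) = ξ⁰`. [cite: Tao2016AveragedNS, §3.7 p. 19] -/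
theorem closTarget_xi0 : closTarget xi0 = xi0 := by
  have he : closE xi0 = xi0 2 := by rw [closE, udir, norm_xi0_two, inv_one, one_smul]
  have h02 : ⟪xi0 0, xi0 2⟫ = 0 := by simp [real_inner_fin3, xi0]
  have hv : closV xi0 = xi0 0 := by rw [closV, he, h02, zero_smul, sub_zero]
  have hf : closF xi0 = xi0 0 := by rw [closF, hv, udir, norm_xi0_zero, inv_one, one_smul]
  have hα : closAlpha xi0 = 0 := by
    rw [closAlpha, norm_xi0_zero, norm_xi0_one, norm_xi0_two, Real.sq_sqrt (by norm_num)]; norm_num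
  have hβ : closBeta xi0 = 1 := by
    rw [closBeta, hα, norm_xi0_zero]; norm_num
  have h0 : closZeta0 xi0 = xi0 0 := by
    rw [closZeta0, hα, hβ, hf, neg_zero, zero_smul, zero_add, one_smul]
  funext j
  match j with
  | 0 => simp only [closTarget, Matrix.cons_val_zero, h0]
  | 1 =>
    simp only [closTarget, Matrix.cons_val_one, Matrix.cons_val_zero, h0]
    ext i
    fin_cases i <;> simp [xi0]
  | 2 => rfl

/-- The configuration (3.7) is admissible. [folklore] -/
theorem closGood_xi0 : ClosGood xi0 := by
  have he : closE xi0 = xi0 2 := by rw [closE, udir, norm_xi0_two, inv_one, one_smul]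
  have h02 : ⟪xi0 0, xi0 2⟫ = 0 := by simp [real_inner_fin3, xi0]
  have hv : closV xi0 = xi0 0 := by rw [closV, he, h02, zero_smul, sub_zero]
  have hα : closAlpha xi0 = 0 := by
    rw [closAlpha, norm_xi0_zero, norm_xi0_one, norm_xi0_two, Real.sq_sqrt (by norm_num)]; norm_num
  refine ⟨xi0_ne_zero 2, by rw [hv]; exact xi0_ne_zero 0, ?_⟩
  rw [hα, norm_xi0_zero]; norm_num

/-- **The closing rotations `R_{j,ξ₁,ξ₂,ξ₃}`** of §3.7: the rotations `rotTo` (of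
`TaoAveragedRotations.lean`) taking the direction of `ξ₁` to that of `ξ̃₁`, of `ξ₂` to that of `ξ̃₂`,
and the identity in the third slot (Tao: "one can find rotations
`R_{j,ξ₁,ξ₂,ξ₃} ∈ SO(3)` … with `R_{j,ξ₁,ξ₂,ξ₃} = I + O(ε₀³)` and the tuple `ξ̃ⱼ := R_{j,ξ₁,ξ₂,ξ₃} ξⱼ`
lives in `Γ`"). [cite: Tao2016AveragedNS, §3.7 (3.17)–(3.18) p. 19] -/
def closRot (ξ : Fin 3 → ℝ³) : Fin 3 → (ℝ³ ≃ₗᵢ[ℝ] ℝ³) :=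
  ![rotToEquiv (udir (ξ 0)) (udir (closTarget ξ 0)), rotToEquiv (udir (ξ 1)) (udir (closTarget ξ 1)),
    LinearIsometryEquiv.refl ℝ ℝ³]

/-- `R_{j,ξ} ∈ SO(3)`: determinant one. [cite: Tao2016AveragedNS, §3.7 p. 19] -/
theorem det_closRot (ξ : Fin 3 → ℝ³) (j : Fin 3) :
    LinearMap.det ((closRot ξ j).toLinearEquiv : ℝ³ →ₗ[ℝ] ℝ³) = 1 := by
  match j with
  | 0 => exact det_rotToEquiv _ _
  | 1 => exact det_rotToEquiv _ _
  | 2 => exact LinearMap.det_id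

/-- Unit vectors at an obtuse-free angle are an admissible pair for `rotTo`. [folklore] -/
theorem rotToAdmissible_udir {a b : ℝ³} (ha : a ≠ 0) (hb : b ≠ 0) (hab : -(‖a‖ * ‖b‖) < ⟪a, b⟫) :
    RotToAdmissible (udir a) (udir b) := by
  refine ⟨norm_udir ha, norm_udir hb, ?_⟩
  have hpos : 0 < ‖a‖ * ‖b‖ := mul_pos (norm_pos_iff.mpr ha) (norm_pos_iff.mpr hb)
  have h : ⟪udir a, udir b⟫ = ⟪a, b⟫ / (‖a‖ * ‖b‖) := by
    rw [udir, udir, real_inner_smul_left, real_inner_smul_right]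
    field_simp
  rw [h]
  intro habs
  rw [div_eq_iff hpos.ne'] at habs
  linarith

/-- At the configuration (3.7) the closing rotations act as the identity. [cite: Tao2016AveragedNS, §3.7 p. 19] -/
theorem closRot_xi0_apply (j : Fin 3) (X : ℝ³) : closRot xi0 j X = X := by
  have hadm : ∀ i, RotToAdmissible (udir (xi0 i)) (udir (xi0 i)) := fun i =>
    rotToAdmissible_udir (xi0_ne_zero i) (xi0_ne_zero i)
      (by rw [real_inner_self_eq_norm_sq]; nlinarith [norm_pos_iff.mpr (xi0_ne_zero i)])
  match j with
  | 0 =>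
    simp only [closRot, Matrix.cons_val_zero, closTarget_xi0]
    rw [rotToEquiv_apply (hadm 0), rotTo_self (hadm 0).1]
  | 1 =>
    simp only [closRot, Matrix.cons_val_one, Matrix.cons_val_zero, closTarget_xi0]
    rw [rotToEquiv_apply (hadm 1), rotTo_self (hadm 1).1]
  | 2 => rfl

/-- The full admissibility: in addition `ξ₁, ξ₂ ≠ 0` and the pairs `(ξⱼ, ξ̃ⱼ)`, `j = 1, 2`, are
not antipodal (`ξⱼ · ξ̃ⱼ > -|ξⱼ||ξ̃ⱼ|`), so that `rotTo` applies to their directions. [folklore] -/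
def ClosAdmissible (ξ : Fin 3 → ℝ³) : Prop :=
  ClosGood ξ ∧ ξ 0 ≠ 0 ∧ ξ 1 ≠ 0 ∧
    -(‖ξ 0‖ * ‖closTarget ξ 0‖) < ⟪ξ 0, closTarget ξ 0⟫ ∧ -(‖ξ 1‖ * ‖closTarget ξ 1‖) < ⟪ξ 1, closTarget ξ 1⟫

/-- The admissible pairs of directions. [folklore] -/
theorem ClosAdmissible.rotToAdmissible (h : ClosAdmissible ξ) :
    RotToAdmissible (udir (ξ 0)) (udir (closTarget ξ 0)) ∧ RotToAdmissible (udir (ξ 1)) (udir (closTarget ξ 1)) := by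
  obtain ⟨hg, h0, h1, hi0, hi1⟩ := h
  have hz0 : closTarget ξ 0 ≠ 0 := by
    rw [← norm_ne_zero_iff, norm_closTarget_zero hg, norm_ne_zero_iff]; exact h0
  have hz1 : closTarget ξ 1 ≠ 0 := by
    rw [← norm_ne_zero_iff, norm_closTarget_one hg, norm_ne_zero_iff]; exact h1
  exact ⟨rotToAdmissible_udir h0 hz0 hi0, rotToAdmissible_udir h1 hz1 hi1⟩

/-- A rotation taking the direction of `a` to that of `b` takes `a` to `b` when `|a| = |b|`. [folklore] -/
theorem rotToEquiv_udir_apply {a b : ℝ³} (ha : a ≠ 0) (hb : b ≠ 0) (h : RotToAdmissible (udir a) (udir b))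
    (hnorm : ‖a‖ = ‖b‖) : rotToEquiv (udir a) (udir b) a = b := by
  have h1 : rotToEquiv (udir a) (udir b) a = rotToEquiv (udir a) (udir b) (‖a‖ • udir a) := by
    congr 1
    exact eq_norm_smul_udir ha
  rw [h1, LinearIsometryEquiv.map_smul, rotToEquiv_self_apply h, hnorm, ← eq_norm_smul_udir hb]

/-- **`R_{j,ξ} ξⱼ = ξ̃ⱼ`** on the admissible region. [cite: Tao2016AveragedNS, §3.7 (3.17) p. 19] -/
theorem closRot_apply_self (h : ClosAdmissible ξ) (j : Fin 3) : closRot ξ j (ξ j) = closTarget ξ j := by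
  obtain ⟨hr0, hr1⟩ := h.rotToAdmissible
  obtain ⟨hg, h0, h1, -, -⟩ := h
  have hz0 : closTarget ξ 0 ≠ 0 := by
    rw [← norm_ne_zero_iff, norm_closTarget_zero hg, norm_ne_zero_iff]; exact h0
  have hz1 : closTarget ξ 1 ≠ 0 := by
    rw [← norm_ne_zero_iff, norm_closTarget_one hg, norm_ne_zero_iff]; exact h1
  match j with
  | 0 =>
    simp only [closRot, Matrix.cons_val_zero]
    exact rotToEquiv_udir_apply h0 hz0 hr0 (norm_closTarget_zero hg).symm
  | 1 =>
    simp only [closRot, Matrix.cons_val_one, Matrix.cons_val_zero]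
    exact rotToEquiv_udir_apply h1 hz1 hr1 (norm_closTarget_one hg).symm
  | 2 => rfl

/-- **`R_{1,ξ} ξ₁ + R_{2,ξ} ξ₂ + R_{3,ξ} ξ₃ = 0`**: the rotated triple lies in `Γ` ((3.18)). [cite: Tao2016AveragedNS, §3.7 (3.18) p. 19] -/
theorem sum_closRot_apply_self (h : ClosAdmissible ξ) :
    closRot ξ 0 (ξ 0) + closRot ξ 1 (ξ 1) + closRot ξ 2 (ξ 2) = 0 := by
  rw [closRot_apply_self h 0, closRot_apply_self h 1, closRot_apply_self h 2, closTarget_sum]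

end Closing

/-! ### Admissibility, smoothness and the closing rotations near the configuration (3.7) -/

section NearXi0

variable {n : WithTop ℕ∞} {ξ₀ : Fin 3 → ℝ³}

/-- `ξ ↦ e(ξ)` is smooth where `ξ₃ ≠ 0`. [folklore] -/
theorem contDiffAt_closE (h2 : ξ₀ 2 ≠ 0) : ContDiffAt ℝ n closE ξ₀ :=
  ContDiffAt.comp ξ₀ (g := udir) (f := fun ξ : Fin 3 → ℝ³ => ξ 2) (contDiffAt_udir h2)
    (contDiffAt_apply ℝ ℝ³ 2 ξ₀)

/-- `ξ ↦ v(ξ)` is smooth where `ξ₃ ≠ 0`. [folklore] -/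
theorem contDiffAt_closV (h2 : ξ₀ 2 ≠ 0) : ContDiffAt ℝ n closV ξ₀ := by
  have h0 : ContDiffAt ℝ n (fun ξ : Fin 3 → ℝ³ => ξ 0) ξ₀ := contDiffAt_apply ℝ ℝ³ 0 ξ₀
  have hE := contDiffAt_closE (n := n) h2
  unfold closV
  exact h0.sub ((h0.inner ℝ hE).smul hE)

/-- `ξ ↦ f(ξ)` is smooth on the admissible region. [folklore] -/
theorem contDiffAt_closF (h : ClosGood ξ₀) : ContDiffAt ℝ n closF ξ₀ :=
  ContDiffAt.comp ξ₀ (g := udir) (f := closV) (contDiffAt_udir h.2.1) (contDiffAt_closV h.1)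

/-- `ξ ↦ α(ξ)` is smooth where `ξ₃ ≠ 0`. [folklore] -/
theorem contDiffAt_closAlpha (h2 : ξ₀ 2 ≠ 0) : ContDiffAt ℝ n closAlpha ξ₀ := by
  have hsq : ∀ j, ContDiffAt ℝ n (fun ξ : Fin 3 → ℝ³ => ‖ξ j‖ ^ 2) ξ₀ := fun j =>
    (contDiffAt_apply ℝ ℝ³ j ξ₀).norm_sq ℝ
  have hn2 : ContDiffAt ℝ n (fun ξ : Fin 3 → ℝ³ => ‖ξ 2‖) ξ₀ := (contDiffAt_apply ℝ ℝ³ 2 ξ₀).norm ℝ h2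
  unfold closAlpha
  exact (((hsq 2).add (hsq 0)).sub (hsq 1)).div (contDiffAt_const.mul hn2)
    (mul_ne_zero two_ne_zero (norm_ne_zero_iff.mpr h2))

/-- `ξ ↦ β(ξ)` is smooth on the admissible region (the radicand is positive). [folklore] -/
theorem contDiffAt_closBeta (h : ClosGood ξ₀) : ContDiffAt ℝ n closBeta ξ₀ := by
  have hsq : ContDiffAt ℝ n (fun ξ : Fin 3 → ℝ³ => ‖ξ 0‖ ^ 2) ξ₀ := (contDiffAt_apply ℝ ℝ³ 0 ξ₀).norm_sq ℝ
  unfold closBeta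
  exact (hsq.sub ((contDiffAt_closAlpha h.1).pow 2)).sqrt (by linarith [h.2.2])

/-- `ξ ↦ ξ̃₁(ξ)` is smooth on the admissible region. [folklore] -/
theorem contDiffAt_closZeta0 (h : ClosGood ξ₀) : ContDiffAt ℝ n closZeta0 ξ₀ := by
  unfold closZeta0
  exact ((contDiffAt_closAlpha h.1).neg.smul (contDiffAt_closE h.1)).add
    ((contDiffAt_closBeta h).smul (contDiffAt_closF h))

/-- **`ξ ↦ ξ̃ⱼ(ξ)` is smooth** on the admissible region (Tao: "`ξ̃₁, ξ̃₂, ξ̃₃` depend smoothly on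
`ξ₁,ξ₂,ξ₃`"). [cite: Tao2016AveragedNS, §3.7 p. 19] -/
theorem contDiffAt_closTarget (h : ClosGood ξ₀) (j : Fin 3) :
    ContDiffAt ℝ n (fun ξ => closTarget ξ j) ξ₀ := by
  match j with
  | 0 =>
    simp only [closTarget, Matrix.cons_val_zero]
    exact contDiffAt_closZeta0 h
  | 1 =>
    simp only [closTarget, Matrix.cons_val_one, Matrix.cons_val_zero]
    exact (contDiffAt_apply ℝ ℝ³ 2 ξ₀).neg.sub (contDiffAt_closZeta0 h)
  | 2 =>
    simp only [closTarget_two]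
    exact contDiffAt_apply ℝ ℝ³ 2 ξ₀

/-- **Admissibility holds near the configuration (3.7).** [folklore] -/
theorem closAdmissible_nhds : ∀ᶠ ξ in 𝓝 xi0, ClosAdmissible ξ := by
  have hg := closGood_xi0
  -- the quantities and their values at `ξ⁰`
  have hv0 : closV xi0 ≠ 0 := hg.2.1
  have hT : ∀ j, closTarget xi0 j = xi0 j := fun j => by rw [closTarget_xi0]
  -- continuity at `ξ⁰`
  have c2 : ContinuousAt (fun ξ : Fin 3 → ℝ³ => ξ 2) xi0 := (continuous_apply 2).continuousAt
  have cv : ContinuousAt closV xi0 := (contDiffAt_closV (n := 0) hg.1).continuousAt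
  have crad : ContinuousAt (fun ξ : Fin 3 → ℝ³ => ‖ξ 0‖ ^ 2 - closAlpha ξ ^ 2) xi0 := by
    have h' : ContDiffAt ℝ 0 (fun ξ : Fin 3 → ℝ³ => ‖ξ 0‖ ^ 2 - closAlpha ξ ^ 2) xi0 :=
      ((contDiffAt_apply ℝ ℝ³ 0 xi0).norm_sq ℝ).sub ((contDiffAt_closAlpha hg.1).pow 2)
    exact h'.continuousAt
  have cin : ∀ j, ContinuousAt (fun ξ : Fin 3 → ℝ³ =>
      ⟪ξ j, closTarget ξ j⟫ + ‖ξ j‖ * ‖closTarget ξ j‖) xi0 := by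
    intro j
    have h' : ContDiffAt ℝ 0 (fun ξ : Fin 3 → ℝ³ => ⟪ξ j, closTarget ξ j⟫ + ‖ξ j‖ * ‖closTarget ξ j‖) xi0 :=
      ((contDiffAt_apply ℝ ℝ³ j xi0).inner ℝ (contDiffAt_closTarget hg j)).add
        (((contDiffAt_apply ℝ ℝ³ j xi0).norm ℝ (xi0_ne_zero j)).mul
          ((contDiffAt_closTarget hg j).norm ℝ (by rw [hT]; exact xi0_ne_zero j)))
    exact h'.continuousAt
  have cj : ∀ j, ContinuousAt (fun ξ : Fin 3 → ℝ³ => ξ j) xi0 := fun j => (continuous_apply j).continuousAt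
  -- positivity at `ξ⁰`
  have prad : 0 < ‖xi0 0‖ ^ 2 - closAlpha xi0 ^ 2 := by linarith [hg.2.2]
  have pin : ∀ j, 0 < ⟪xi0 j, closTarget xi0 j⟫ + ‖xi0 j‖ * ‖closTarget xi0 j‖ := by
    intro j
    rw [hT, real_inner_self_eq_norm_sq]
    have : 0 < ‖xi0 j‖ := norm_pos_iff.mpr (xi0_ne_zero j)
    positivity
  -- eventual statements
  have e2 : ∀ᶠ ξ in 𝓝 xi0, ξ 2 ≠ 0 := c2.eventually_ne (xi0_ne_zero 2)
  have e0 : ∀ᶠ ξ in 𝓝 xi0, ξ 0 ≠ 0 := (cj 0).eventually_ne (xi0_ne_zero 0)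
  have e1 : ∀ᶠ ξ in 𝓝 xi0, ξ 1 ≠ 0 := (cj 1).eventually_ne (xi0_ne_zero 1)
  have ev : ∀ᶠ ξ in 𝓝 xi0, closV ξ ≠ 0 := cv.eventually_ne hv0
  have erad : ∀ᶠ ξ in 𝓝 xi0, 0 < ‖ξ 0‖ ^ 2 - closAlpha ξ ^ 2 := crad.eventually (lt_mem_nhds prad)
  have ein : ∀ j, ∀ᶠ ξ in 𝓝 xi0, 0 < ⟪ξ j, closTarget ξ j⟫ + ‖ξ j‖ * ‖closTarget ξ j‖ := fun j =>
    (cin j).eventually (lt_mem_nhds (pin j))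
  filter_upwards [e2, e0, e1, ev, erad, ein 0, ein 1] with ξ h2 h0 h1 hv hrad hi0 hi1
  exact ⟨⟨h2, hv, by linarith⟩, h0, h1, by linarith, by linarith⟩

/-- On an admissible neighbourhood the closing rotations act by the closed form `rotTo`, hence
**`ξ ↦ R_{j,ξ} X` is smooth** (Tao: "from the implicit function theorem we may make `R_{j,ξ₁,ξ₂,ξ₃}`
and hence `ξ̃₁, ξ̃₂, ξ̃₃` depend smoothly on `ξ₁,ξ₂,ξ₃`"). [cite: Tao2016AveragedNS, §3.7 p. 19] -/
theorem contDiffAt_closRot_apply (h : ∀ᶠ ξ in 𝓝 ξ₀, ClosAdmissible ξ) (j : Fin 3) (X : ℝ³) :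
    ContDiffAt ℝ n (fun ξ => closRot ξ j X) ξ₀ := by
  have h₀ : ClosAdmissible ξ₀ := h.self_of_nhds
  obtain ⟨hr0, hr1⟩ := h₀.rotToAdmissible
  obtain ⟨hg, h0, h1, -, -⟩ := h₀
  have hz0 : closTarget ξ₀ 0 ≠ 0 := by
    rw [← norm_ne_zero_iff, norm_closTarget_zero hg, norm_ne_zero_iff]; exact h0
  have hz1 : closTarget ξ₀ 1 ≠ 0 := by
    rw [← norm_ne_zero_iff, norm_closTarget_one hg, norm_ne_zero_iff]; exact h1
  -- smoothness of the two unit-vector fields of slot `i`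
  have hud : ∀ i, ξ₀ i ≠ 0 → closTarget ξ₀ i ≠ 0 → ContDiffAt ℝ n
      (fun ξ : Fin 3 → ℝ³ => (udir (ξ i), (udir (closTarget ξ i), X))) ξ₀ := by
    intro i hi hzi
    refine (ContDiffAt.comp ξ₀ (g := udir) (f := fun ξ : Fin 3 → ℝ³ => ξ i) (contDiffAt_udir hi)
      (contDiffAt_apply ℝ ℝ³ i ξ₀)).prodMk ((ContDiffAt.comp ξ₀ (g := udir) (f := fun ξ => closTarget ξ i)
        (contDiffAt_udir hzi) (contDiffAt_closTarget hg i)).prodMk contDiffAt_const)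
  match j with
  | 0 =>
    have heq : (fun ξ => closRot ξ 0 X) =ᶠ[𝓝 ξ₀] fun ξ => rotTo (udir (ξ 0)) (udir (closTarget ξ 0)) X := by
      filter_upwards [h] with ξ hξ
      simp only [closRot, Matrix.cons_val_zero]
      exact rotToEquiv_apply hξ.rotToAdmissible.1 X
    refine ContDiffAt.congr_of_eventuallyEq ?_ heq
    have hp : 1 + ⟪udir (ξ₀ 0), udir (closTarget ξ₀ 0)⟫ ≠ 0 := fun h' =>
      hr0.2.2 (by linarith)
    exact ContDiffAt.comp ξ₀ (g := fun q : ℝ³ × ℝ³ × ℝ³ => rotTo q.1 q.2.1 q.2.2)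
      (f := fun ξ : Fin 3 → ℝ³ => (udir (ξ 0), (udir (closTarget ξ 0), X)))
      (contDiffAt_rotTo (p := (udir (ξ₀ 0), (udir (closTarget ξ₀ 0), X))) hp) (hud 0 h0 hz0)
  | 1 =>
    have heq : (fun ξ => closRot ξ 1 X) =ᶠ[𝓝 ξ₀] fun ξ => rotTo (udir (ξ 1)) (udir (closTarget ξ 1)) X := by
      filter_upwards [h] with ξ hξ
      simp only [closRot, Matrix.cons_val_one, Matrix.cons_val_zero]
      exact rotToEquiv_apply hξ.rotToAdmissible.2 X
    refine ContDiffAt.congr_of_eventuallyEq ?_ heq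
    have hp : 1 + ⟪udir (ξ₀ 1), udir (closTarget ξ₀ 1)⟫ ≠ 0 := fun h' =>
      hr1.2.2 (by linarith)
    exact ContDiffAt.comp ξ₀ (g := fun q : ℝ³ × ℝ³ × ℝ³ => rotTo q.1 q.2.1 q.2.2)
      (f := fun ξ : Fin 3 → ℝ³ => (udir (ξ 1), (udir (closTarget ξ 1), X)))
      (contDiffAt_rotTo (p := (udir (ξ₀ 1), (udir (closTarget ξ₀ 1), X))) hp) (hud 1 h1 hz1)
  | 2 =>
    simp only [closRot, Matrix.cons_val_two, Matrix.tail_cons, Matrix.head_cons, LinearIsometryEquiv.coe_refl,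
      id_eq]
    exact contDiffAt_const

/-- **The closing rotations of §3.7, near the configuration (3.7)** (Tao 2016, (3.17)–(3.18) and
the sentence before them): there is `δ > 0` such that for all `ξ = (ξ₁,ξ₂,ξ₃)` with
`|ξⱼ - ξⱼ⁰| < δ` the rotations `R_{j,ξ} := closRot ξ j ∈ SO(3)` (`det_closRot`) satisfy:
`R_{j,ξ} ξⱼ = ξ̃ⱼ` with `|ξ̃ⱼ| = |ξⱼ|`, the closed triangle `ξ̃₁ + ξ̃₂ + ξ̃₃ = 0` (so
`ξ̃ = closTarget ξ ∈ Γ` once `ξ̃ⱼ ∈ B(ξⱼ⁰, Cε₀³)`, which follows from the continuity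
`contDiffAt_closTarget` and `closTarget_xi0`), and `ξ ↦ R_{j,ξ} X`, `ξ ↦ ξ̃ⱼ(ξ)` are smooth there;
moreover `R_{j,ξ⁰} = I` and `ξ̃(ξ⁰) = ξ⁰` (`closRot_xi0_apply`, `closTarget_xi0`), the qualitative form of
"`R_{j,ξ₁,ξ₂,ξ₃} = I + O(ε₀³)`". An explicit substitute for the implicit function theorem. [cite: Tao2016AveragedNS, §3.7 (3.17)–(3.18) p. 19] -/
theorem closingRotations_near_xi0 : ∃ δ : ℝ, 0 < δ ∧ ∀ ξ : Fin 3 → ℝ³, (∀ j, ‖ξ j - xi0 j‖ < δ) →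
    ClosAdmissible ξ ∧
      closRot ξ 0 (ξ 0) + closRot ξ 1 (ξ 1) + closRot ξ 2 (ξ 2) = 0 ∧
        (∀ j, closRot ξ j (ξ j) = closTarget ξ j ∧ ‖closTarget ξ j‖ = ‖ξ j‖) ∧
          (∀ (j : Fin 3) (X : ℝ³), ContDiffAt ℝ ((⊤ : ℕ∞) : WithTop ℕ∞) (fun ξ' => closRot ξ' j X) ξ) ∧
            ∀ j : Fin 3, ContDiffAt ℝ ((⊤ : ℕ∞) : WithTop ℕ∞) (fun ξ' => closTarget ξ' j) ξ := by
  obtain ⟨δ, hδ, hball⟩ := Metric.eventually_nhds_iff_ball.mp closAdmissible_nhds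
  refine ⟨δ, hδ, fun ξ hξ => ?_⟩
  have hmem : ξ ∈ Metric.ball xi0 δ := by
    rw [Metric.mem_ball, dist_pi_lt_iff hδ]
    intro j
    rw [dist_eq_norm]
    exact hξ j
  have hadm : ClosAdmissible ξ := hball ξ hmem
  have hnhds : ∀ᶠ ξ' in 𝓝 ξ, ClosAdmissible ξ' := by
    filter_upwards [Metric.isOpen_ball.mem_nhds hmem] with ξ' hξ' using hball ξ' hξ'
  refine ⟨hadm, sum_closRot_apply_self hadm, fun j => ⟨closRot_apply_self hadm j, norm_closTarget hadm.1 j⟩,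
    fun j X => contDiffAt_closRot_apply hnhds j X, fun j => contDiffAt_closTarget hadm.1 j⟩

end NearXi0

end Literature.Analysis.FluidPDE.Tao2016
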